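import Summits.QuantumFields.QCD.Theorems.PauliWegnerSeaFMClosureUnquenchedRepairedC2

/-!
# Crux `FMClosureUnquenched` (stmt-QuantumFields-11512), line `von-mises-circles`: the repaired core from the AVERAGED two-star package

**Theorem (`coreOutward_of_twoStarBounds_farStability`).** The averaged two-star package `∀ N_f, TwoStarBounds N_f`
(ASFH's a-priori bound (T5), decoupling (Tdec), spanning-factor removal (T1), no-junk clauses (T0)/(Tinv), all as
PHASE-QUENCHED EXPECTATIONS — `Theorems/PauliWegnerSeaFMClosureUnquenchedDefs.lean` §2) and far stability give the repaired
core of K2 for every regularisation and every mass tuple: the one-scale input with `2 ≤ ℓ₀` implies clause (ii) of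
`MobilityGap` OUTWARD (for `K (1 + |log a_k|) ≤ a_k ‖v‖`).

Why this second dress of the repaired composition (lead c2, instance B): `VonMisesCirclesC2.coreOutward_of_localCofactorDomination_
farStability` (p141195) takes the DETERMINISTIC, fibre-wise-uniform K1♭ `LocalCofactorDomination` as antecedent and derives the
averaged package from it (`stub_twoStar`).  K1♭ is a sup statement over every background and dies at a single realisable dark leaf
(the stmt-11510 question); the closure (`closure_from_two`) never uses K1♭, only the averaged package, which is insensitive to
measure-zero sets of backgrounds.  So `K2″ := (∀ N_f, TwoStarBounds N_f) → (∀ N_f, FarStability N_f) → CoreOutward` is the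
weakest restatement the landed bootstrap closes, and it is closed HERE; the planner may file the averaged package (a Wegner-type
a-priori bound for the phase-quenched gauge measure) instead of, or beside, K1♭ as the route's non-physical crux.

References: Aizenman–Schenker–Friedrich–Hundertmark, CMP 224 (2001) 219, Lemmas 4–6 and Thm 2 [AizenmanEtAl2001].
-/

noncomputable section

namespace Summit.QuantumFields.QCD.Theorems.VonMisesCirclesC2B

open scoped BigOperators
open MeasureTheory Filter
open Literature.MathematicalPhysics.QuantumFieldTheory Literature.MathematicalPhysics.QuantumLattice
  Literature.Probability.LatticeModels
open Summit.QuantumFields.QCD.Theorems.VonMisesCircles Summit.QuantumFields.QCD.Theorems.VonMisesCirclesC2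

/-- **The repaired core of K2 from the averaged two-star package and far stability** (registered sub-goal
`coreOutward_of_twoStarBounds_farStability` of stmt-QuantumFields-11512): for every `N_f`, regularisation and mass tuple, the
one-scale input WITH `2 ≤ ℓ₀` implies the OUTWARD conclusion; `cruxMoment`/`bareMass` are the crux's integrands verbatim
(`…FMClosureUnquenchedDefs` §0).  No sign condition on `β_k`, no bare-mass range, no mass positivity, and NO cofactor
domination. [cite: AizenmanEtAl2001, Thm 2] -/
theorem coreOutward_of_twoStarBounds_farStability :
    (∀ Nf : ℕ, TwoStarBounds Nf) → (∀ Nf : ℕ, FarStability Nf) →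
    ∀ (Nf : ℕ) (reg : QCDRegularisation Nf) (m : Fin Nf → ℝ),
      (∀ q : ℕ, ∃ K₀ s : ℝ, 0 < s ∧ s < 1 ∧ ∀ᶠ k in atTop, ∃ ℓ₀ : ℕ, 2 ≤ ℓ₀ ∧ ℓ₀ ≤ reg.L k ∧
        (ℓ₀ : ℝ) * reg.a k ≤ K₀ * (1 + |Real.log (reg.a k)|) ∧
        ∀ S : ℕ, reg.L k ≤ S → ∀ (f : Fin Nf) (v : Literature.Probability.LatticeModels.Site 4),
          v ∈ box 4 S → ‖v‖ = (ℓ₀ : ℝ) →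
            (ℓ₀ : ℝ) ^ q * (1 + |reg.β k|) ^ q * cruxMoment Nf (reg.β k) (bareMass reg m k) S f v s ≤ 1) →
      ∃ s δ C K : ℝ, 0 < s ∧ s < 1 ∧ 0 < δ ∧ ∀ᶠ k in atTop, ∀ S : ℕ, reg.L k ≤ S →
        ∀ (f : Fin Nf) (v : Literature.Probability.LatticeModels.Site 4), v ∈ box 4 S →
          K * (1 + |Real.log (reg.a k)|) ≤ reg.a k * ‖v‖ →
            cruxMoment Nf (reg.β k) (bareMass reg m k) S f v s ≤ C * Real.exp (-(δ * (reg.a k * ‖v‖))) := by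
  intro hT hF Nf reg m hIn
  obtain ⟨s, δ, C, K₀, ℓ₀, hs0, hs1, hδ, _hC, hwin, -, hdec⟩ :=
    closure_from_two Nf reg m (hT Nf) (hF Nf) collarResolventBounds_holds (hoppingDecay_holds Nf) hIn
  refine ⟨s, δ, C, K₀, hs0, hs1, hδ, ?_⟩
  filter_upwards [hwin, hdec] with k hkwin hk S hS f v hv hfar
  have hℓ : (ℓ₀ k f : ℝ) ≤ ‖v‖ := by
    have ha : 0 < reg.a k := reg.a_pos k
    have h1 : (ℓ₀ k f : ℝ) * reg.a k ≤ reg.a k * ‖v‖ := (hkwin f).trans hfar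
    nlinarith
  exact hk S hS f v hv hℓ

/-- The same with the crux's integrands written out (hypothesis and conclusion integrand-by-integrand the texts of
`PauliWegnerSea.FMClosureUnquenched`, input radius `2 ≤ ℓ₀`, conclusion guarded by `K (1 + |log a_k|) ≤ a_k ‖v‖`) —
the candidate restatement `K2″` with its closing term. [cite: AizenmanEtAl2001, Thm 2] -/
theorem coreOutward_of_twoStarBounds_farStability_unfolded (hT : ∀ Nf : ℕ, TwoStarBounds Nf)
    (hF : ∀ Nf : ℕ, FarStability Nf) :
    ∀ (Nf : ℕ) (reg : QCDRegularisation Nf) (m : Fin Nf → ℝ),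
      (∀ q : ℕ, ∃ K₀ s : ℝ, 0 < s ∧ s < 1 ∧ ∀ᶠ k in atTop, ∃ ℓ₀ : ℕ, 2 ≤ ℓ₀ ∧ ℓ₀ ≤ reg.L k ∧
        (ℓ₀ : ℝ) * reg.a k ≤ K₀ * (1 + |Real.log (reg.a k)|) ∧
        ∀ S : ℕ, reg.L k ≤ S → ∀ (f : Fin Nf) (v : Literature.Probability.LatticeModels.Site 4),
          v ∈ box 4 S → ‖v‖ = (ℓ₀ : ℝ) →
            (ℓ₀ : ℝ) ^ q * (1 + |reg.β k|) ^ q *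
              ((∫ U : GaugeConfig 4 (2 * S + 1) (Matrix.specialUnitaryGroup (Fin 3) ℂ),
                  ‖(diracMatrix U fun fl => reg.mcrit k + reg.a k * m fl / reg.Zm k).det‖ *
                    (∑ a : Fin 3, ∑ i : Fin 4, ∑ b : Fin 3, ∑ j : Fin 4,
                      ‖(diracMatrix U fun fl => reg.mcrit k + reg.a k * m fl / reg.Zm k)⁻¹
                        (quarkEquiv (f, (Torus.proj (2 * S + 1) 0, a, i)))
                        (quarkEquiv (f, (Torus.proj (2 * S + 1) (v), b, j)))‖) ^ s
                  ∂(wilsonMeasure (fundamentalRep (Fin 3)) (reg.β k))) /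
                (∫ U : GaugeConfig 4 (2 * S + 1) (Matrix.specialUnitaryGroup (Fin 3) ℂ),
                  ‖(diracMatrix U fun fl => reg.mcrit k + reg.a k * m fl / reg.Zm k).det‖
                  ∂(wilsonMeasure (fundamentalRep (Fin 3)) (reg.β k)))) ≤ 1) →
      ∃ s δ C K : ℝ, 0 < s ∧ s < 1 ∧ 0 < δ ∧ ∀ᶠ k in atTop, ∀ S : ℕ, reg.L k ≤ S →
        ∀ (f : Fin Nf) (v : Literature.Probability.LatticeModels.Site 4), v ∈ box 4 S →
          K * (1 + |Real.log (reg.a k)|) ≤ reg.a k * ‖v‖ →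
            (∫ U : GaugeConfig 4 (2 * S + 1) (Matrix.specialUnitaryGroup (Fin 3) ℂ),
                ‖(diracMatrix U fun fl => reg.mcrit k + reg.a k * m fl / reg.Zm k).det‖ *
                  (∑ a : Fin 3, ∑ i : Fin 4, ∑ b : Fin 3, ∑ j : Fin 4,
                    ‖(diracMatrix U fun fl => reg.mcrit k + reg.a k * m fl / reg.Zm k)⁻¹
                      (quarkEquiv (f, (Torus.proj (2 * S + 1) 0, a, i)))
                      (quarkEquiv (f, (Torus.proj (2 * S + 1) (v), b, j)))‖) ^ s
                ∂(wilsonMeasure (fundamentalRep (Fin 3)) (reg.β k))) /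
              (∫ U : GaugeConfig 4 (2 * S + 1) (Matrix.specialUnitaryGroup (Fin 3) ℂ),
                ‖(diracMatrix U fun fl => reg.mcrit k + reg.a k * m fl / reg.Zm k).det‖
                ∂(wilsonMeasure (fundamentalRep (Fin 3)) (reg.β k))) ≤
              C * Real.exp (-(δ * (reg.a k * ‖v‖))) :=
  coreOutward_of_twoStarBounds_farStability hT hF

end Summit.QuantumFields.QCD.Theorems.VonMisesCirclesC2B
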